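import Summits.Ventures.CertifiedManyBodySolver.Downfold.EmeryFermiSurfaceShapeBox
import Literature.MathematicalPhysics.QuantumLattice.CuprateAxialOrbitalDownfold
import HarnessLib

/-!
# The four-orbital (d, s, pₓ, p_y) cuprate model WITH direct oxygen–oxygen hopping: its Fermi surface is
# again EXACTLY a `t–t′` contour, and the axial channel enters the shape through ONE linear parameter

Venture CertifiedManyBodySolver, cell `pub/hubbard-downfold` (stage S1, HUMAN RULINGS D-0096/D-0098),
seat hubbard-downfold-mod-4 (technique B); namespace `Summit.Ventures.CertifiedManyBodySolver.Downfold.Emery`.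
Everything here is PROVED (exact algebra). WHAT THIS IS NOT: a statement about any material; the scale
of the contour hoppings is conventional (only the ratio is physical); the axial level `ε_s` and coupling
`t_sp` are model inputs, not determined here.

`EmeryFermiSurfaceShape` proved: every constant-energy contour of the σ three-band model
(`bloch4`: Δ, t_pd, t_pp, t_pp′) is a pure `t–t′` contour with `t′/t = fsRatio = −fsN/(fsD + 2fsN)`.
The cell's boxes found that this σ value is the WHOLE direct near-Fermi-surface `t′/t` for La₂CuO₄ but
only 45–75 % of it for Hg/Tl/oxychloride/nickelate materials — the rest being the axial (Cu-4s / apical)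
channel of [PavariniEtAl2001]. Here that channel is added EXACTLY:

* §1 `fourBandPP Δ ε_s t_pd t_pp t_pp′ t_sp` — the (d, s, pₓ, p_y) Bloch matrix of [AndersenEtAl1995,
  Eq. (1)] / [PavariniEtAl2001, Eqs. (1)–(3)] (lit-1's `CuprateFourOrbital.fourBand`, `fourBandPP_pure`)
  PLUS the direct O–O hoppings `t_pp` (`−4t_pp sx sy`) and `t_pp′` (`−4t_pp′ sx²`, `−4t_pp′ sy²`) of
  `bloch4`; its characteristic determinant in closed form (`det_fourBandPP_sub`):
  `det(H₄ − ε) = −[(ε_s − ε)·charCubic(t_pp, t_pp′) + t_sp²·axialLin]`, where `axialLin` is the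
  coefficient of the CO-SHIFT: `charCubic(t_pp + a, t_pp′ + a) = charCubic(t_pp, t_pp′) + a·axialLin`
  (`charCubic_coshift` — the secular cubic is AFFINE in a common shift of the two O–O hoppings).
* §2 `det_fourBandPP_eq_zero_iff_charCubic`: for `ε ≠ ε_s` the four-orbital secular equation at `k`
  is the σ secular equation at the co-shifted point `a(ε) = t_sp²/(ε_s − ε)` (Löwdin elimination of s;
  generalises `EmeryAxialShift.det_fourBand_eq_zero_iff_bloch4` to `t_pp, t_pp′ ≠ 0`); hence THE CONTOUR
  THEOREM FOR THE FULL MODEL (`det_fourBandPP_eq_zero_iff_oneBand`): every constant-energy contour of the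
  four-orbital + O–O model is EXACTLY a `t–t′` contour with
  `t′/t = fsRatio Δ t_pd (t_pp + a(ε)) (t_pp′ + a(ε)) ε`.
* §3 THE AXIAL CHANNEL IS ONE LINEAR PARAMETER: `fsN(t_pp + a, t_pp′ + a) = fsN + a·(4t_pd² + 2ε(t_pp −
  t_pp′))`, `fsD(t_pp′ + a) = fsD − a·ε(Δ + ε)` (`fsN_coshift`, `fsD_coshift`), so
  `t′/t = −(n₀ + a n₁)/((d₀ − a d₁) + 2(n₀ + a n₁))` (`fsRatio_coshift`) is ANTITONE in the axial
  admixture `a` (`fsRatio_coshift_anti`: more Cu-4s/apical admixture ⇒ more cuprate-like Fermi surface,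
  the sign content of [PavariniEtAl2001] Fig. 3, exactly and at every filling), and the admixture that
  reproduces a GIVEN near-Fermi-surface ratio `R` (e.g. the direct one-band object-E value) is the closed
  form `axialAdmixture R n₀ n₁ d₀ d₁ = −(R(d₀ + 2n₀) + n₀)/(R(2n₁ − d₁) + n₁)` (`fsRatio_at_axialAdmixture`);
  with Pavarini's `a = t_sp²/(ε_s − ε_F)` this fixes the axial level needed per material
  (`axialLevel_of_admixture`) — the certified replacement of the cell's bisection numerics
  (INFLATION-RULES-3to1-B §B.10).

Sources: [AndersenEtAl1995, §§5–6]; [PavariniEtAl2001, Eqs. (1)–(3), Fig. 3];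
[HybertsenSchluterChristensen1989, Eq. (1)].
-/

noncomputable section

namespace Summit.Ventures.CertifiedManyBodySolver.Downfold.Emery

open Real

/-! ## §1 The four-orbital + O–O Bloch matrix and its determinant -/

/-- The (d, s, pₓ, p_y) Bloch matrix with `ε_d = 0`, axial level `ε_s`, `ε_p = −Δ`, couplings
`t_pd` (d–p, b₁g signs), `t_sp` (s–p, a₁g signs), direct O–O hopping `t_pp` and across-Cu O–O hopping
`t_pp′ = c`; `sx = sin(kx/2)`, `sy = sin(ky/2)`. [cite: AndersenEtAl1995, Eq. (1)];
[cite: PavariniEtAl2001, Eqs. (1)–(3)] -/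
def fourBandPP (Δ εs tpd tpp c tsp sx sy : ℝ) : Matrix (Fin 4) (Fin 4) ℝ :=
  !![0, 0, 2 * tpd * sx, -2 * tpd * sy;
     0, εs, 2 * tsp * sx, 2 * tsp * sy;
     2 * tpd * sx, 2 * tsp * sx, -Δ - 4 * c * sx ^ 2, -4 * tpp * sx * sy;
     -2 * tpd * sy, 2 * tsp * sy, -4 * tpp * sx * sy, -Δ - 4 * c * sy ^ 2]

/-- With `t_pp = t_pp′ = 0` this is lit-1's pure four-orbital matrix `CuprateFourOrbital.fourBand 0 ε_s (−Δ)`.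
[cite: PavariniEtAl2001, Eqs. (1)–(3)] -/
theorem fourBandPP_pure (Δ εs tpd tsp sx sy : ℝ) :
    fourBandPP Δ εs tpd 0 0 tsp sx sy =
      Literature.MathematicalPhysics.QuantumLattice.CuprateFourOrbital.fourBand 0 εs (-Δ) tpd tsp sx sy := by
  ext i j
  fin_cases i <;> fin_cases j <;>
    simp [fourBandPP, Literature.MathematicalPhysics.QuantumLattice.CuprateFourOrbital.fourBand]

/-- The coefficient of the axial co-shift in the σ secular cubic:
`axialLin = 4ε(Δ + ε)(x + y) − 64t_pd²·xy − 32ε(t_pp − t_pp′)·xy`. [folklore] -/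
def axialLin (Δ tpd tpp c x y ε : ℝ) : ℝ :=
  4 * ε * (Δ + ε) * (x + y) - 64 * tpd ^ 2 * (x * y) - 32 * ε * (tpp - c) * (x * y)

/-- THE SECULAR CUBIC IS AFFINE IN A COMMON O–O SHIFT:
`charCubic(t_pp + a, t_pp′ + a) = charCubic(t_pp, t_pp′) + a·axialLin` (the `a²` terms cancel).
[folklore] -/
theorem charCubic_coshift (Δ tpd tpp c a x y ε : ℝ) :
    charCubic Δ tpd (tpp + a) (c + a) x y ε = charCubic Δ tpd tpp c x y ε + a * axialLin Δ tpd tpp c x y ε := by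
  unfold charCubic axialLin
  ring

/-- `fourBandPP − ε·1` written out. [folklore] -/
def secularPP (Δ εs tpd tpp c tsp sx sy ε : ℝ) : Matrix (Fin 4) (Fin 4) ℝ :=
  !![-ε, 0, 2 * tpd * sx, -2 * tpd * sy;
     0, εs - ε, 2 * tsp * sx, 2 * tsp * sy;
     2 * tpd * sx, 2 * tsp * sx, -Δ - 4 * c * sx ^ 2 - ε, -4 * tpp * sx * sy;
     -2 * tpd * sy, 2 * tsp * sy, -4 * tpp * sx * sy, -Δ - 4 * c * sy ^ 2 - ε]

/-- `fourBandPP − ε·1 = secularPP`. [folklore] -/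
theorem fourBandPP_sub_smul (Δ εs tpd tpp c tsp sx sy ε : ℝ) :
    fourBandPP Δ εs tpd tpp c tsp sx sy - ε • (1 : Matrix (Fin 4) (Fin 4) ℝ) =
      secularPP Δ εs tpd tpp c tsp sx sy ε := by
  ext i j
  fin_cases i <;> fin_cases j <;> simp [fourBandPP, secularPP]

/-- THE FOUR-ORBITAL DETERMINANT IN CLOSED FORM (all k, all ε):
`det(H₄ − ε) = −[(ε_s − ε)·charCubic(sx², sy², ε) + t_sp²·axialLin(sx², sy², ε)]`.
[cite: AndersenEtAl1995, Eqs. (2), (5)] -/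
theorem det_fourBandPP_sub (Δ εs tpd tpp c tsp sx sy ε : ℝ) :
    (fourBandPP Δ εs tpd tpp c tsp sx sy - ε • (1 : Matrix (Fin 4) (Fin 4) ℝ)).det =
      -((εs - ε) * charCubic Δ tpd tpp c (sx ^ 2) (sy ^ 2) ε
        + tsp ^ 2 * axialLin Δ tpd tpp c (sx ^ 2) (sy ^ 2) ε) := by
  rw [fourBandPP_sub_smul]
  simp [secularPP, Matrix.det_succ_row_zero, Fin.sum_univ_succ, Fin.succAbove, charCubic, axialLin]
  ring

/-! ## §2 Löwdin elimination of the axial orbital: the co-shifted σ model, and the contour theorem -/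

/-- For `ε ≠ ε_s`: `det(H₄ − ε) = −(ε_s − ε)·charCubic(t_pp + a, t_pp′ + a)` with the axial admixture
`a = t_sp²/(ε_s − ε)` — eliminating the s orbital at energy `ε` co-shifts BOTH oxygen–oxygen hoppings by
`a`. [cite: PavariniEtAl2001, Eqs. (1)–(3)] -/
theorem det_fourBandPP_sub_eq_coshift (Δ εs tpd tpp c tsp sx sy ε : ℝ) (hε : ε ≠ εs) :
    (fourBandPP Δ εs tpd tpp c tsp sx sy - ε • (1 : Matrix (Fin 4) (Fin 4) ℝ)).det =
      -((εs - ε) * charCubic Δ tpd (tpp + tsp ^ 2 / (εs - ε)) (c + tsp ^ 2 / (εs - ε))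
        (sx ^ 2) (sy ^ 2) ε) := by
  have hne : εs - ε ≠ 0 := sub_ne_zero.mpr (Ne.symm hε)
  rw [det_fourBandPP_sub, charCubic_coshift]
  field_simp

/-- THE FOUR-ORBITAL SECULAR EQUATION IS THE CO-SHIFTED σ SECULAR EQUATION (`ε ≠ ε_s`).
[cite: PavariniEtAl2001, Eqs. (1)–(3)] -/
theorem det_fourBandPP_eq_zero_iff_charCubic (Δ εs tpd tpp c tsp sx sy ε : ℝ) (hε : ε ≠ εs) :
    (fourBandPP Δ εs tpd tpp c tsp sx sy - ε • (1 : Matrix (Fin 4) (Fin 4) ℝ)).det = 0 ↔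
      charCubic Δ tpd (tpp + tsp ^ 2 / (εs - ε)) (c + tsp ^ 2 / (εs - ε)) (sx ^ 2) (sy ^ 2) ε = 0 := by
  have hne : εs - ε ≠ 0 := sub_ne_zero.mpr (Ne.symm hε)
  rw [det_fourBandPP_sub_eq_coshift Δ εs tpd tpp c tsp sx sy ε hε, neg_eq_zero, mul_eq_zero]
  constructor
  · rintro (h | h)
    · exact absurd h hne
    · exact h
  · intro h
    exact Or.inr h

/-- … equivalently the `bloch4` secular equation at the co-shifted point (the `t_pp, t_pp′ ≠ 0`
generalisation of `EmeryAxialShift.det_fourBand_eq_zero_iff_bloch4`). [cite: PavariniEtAl2001, Eqs. (1)–(3)] -/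
theorem det_fourBandPP_eq_zero_iff_bloch4 (Δ εs tpd tpp c tsp sx sy ε : ℝ) (hε : ε ≠ εs) :
    (fourBandPP Δ εs tpd tpp c tsp sx sy - ε • (1 : Matrix (Fin 4) (Fin 4) ℝ)).det = 0 ↔
      (bloch4 Δ tpd (tpp + tsp ^ 2 / (εs - ε)) (c + tsp ^ 2 / (εs - ε)) sx sy
        - ε • (1 : Matrix (Fin 3) (Fin 3) ℝ)).det = 0 := by
  rw [det_fourBandPP_eq_zero_iff_charCubic Δ εs tpd tpp c tsp sx sy ε hε,
    det_bloch4_sub_eq_neg_charCubic, neg_eq_zero]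

/-- THE CONTOUR THEOREM FOR THE FOUR-ORBITAL + O–O MODEL: for `ε ≠ ε_s`, `ε` is a band energy at
`k = (kx, ky)` iff `k` lies on the constant-energy contour of the PURE `t–t′` one-band form with the
co-shifted weights, `t = fsT Δ t_pd (t_pp + a) (t_pp′ + a) ε`, `t′ = fsTp t_pd (t_pp + a) (t_pp′ + a) ε`,
`a = t_sp²/(ε_s − ε)`: every constant-energy contour (in particular the Fermi surface at any filling) is
EXACTLY a `t–t′` contour with `t′/t = fsRatio Δ t_pd (t_pp + a) (t_pp′ + a) ε`.
[cite: AndersenEtAl1995, §6]; [cite: PavariniEtAl2001, Eqs. (1)–(3)] -/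
theorem det_fourBandPP_eq_zero_iff_oneBand (Δ εs tpd tpp c tsp kx ky ε γ : ℝ) (hε : ε ≠ εs) :
    (fourBandPP Δ εs tpd tpp c tsp (Real.sin (kx / 2)) (Real.sin (ky / 2))
        - ε • (1 : Matrix (Fin 4) (Fin 4) ℝ)).det = 0 ↔
      oneBand γ (fsT Δ tpd (tpp + tsp ^ 2 / (εs - ε)) (c + tsp ^ 2 / (εs - ε)) ε)
          (fsTp tpd (tpp + tsp ^ 2 / (εs - ε)) (c + tsp ^ 2 / (εs - ε)) ε) 0 kx ky
        = γ - 4 * fsT Δ tpd (tpp + tsp ^ 2 / (εs - ε)) (c + tsp ^ 2 / (εs - ε)) ε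
            - 4 * fsTp tpd (tpp + tsp ^ 2 / (εs - ε)) (c + tsp ^ 2 / (εs - ε)) ε + cA Δ ε := by
  rw [det_fourBandPP_eq_zero_iff_bloch4 Δ εs tpd tpp c tsp _ _ ε hε]
  exact det_bloch4_eq_zero_iff_oneBand _ _ _ _ _ _ _ _

/-! ## §3 The axial channel is ONE linear parameter of the Fermi-surface shape -/

/-- The slope of the diagonal weight under the co-shift: `n₁ = 4t_pd² + 2ε(t_pp − t_pp′)`. [folklore] -/
def fsN1 (tpd tpp c ε : ℝ) : ℝ := 4 * tpd ^ 2 + 2 * ε * (tpp - c)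

/-- The slope of the nearest-neighbour weight under the co-shift: `d₁ = ε(Δ + ε)` (it DEcreases `fsD`).
[folklore] -/
def fsD1 (Δ ε : ℝ) : ℝ := ε * (Δ + ε)

/-- `fsN(t_pp + a, t_pp′ + a) = fsN + a·n₁`. [folklore] -/
theorem fsN_coshift (tpd tpp c a ε : ℝ) :
    fsN tpd (tpp + a) (c + a) ε = fsN tpd tpp c ε + a * fsN1 tpd tpp c ε := by
  unfold fsN fsN1
  ring

/-- `fsD(t_pp′ + a) = fsD − a·d₁`. [folklore] -/
theorem fsD_coshift (Δ tpd c a ε : ℝ) : fsD Δ tpd (c + a) ε = fsD Δ tpd c ε - a * fsD1 Δ ε := by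
  unfold fsD fsD1
  ring

/-- The Fermi-surface ratio of the full model as a Möbius function of the axial admixture `a`:
`t′/t = −(n₀ + a n₁)/((d₀ − a d₁) + 2(n₀ + a n₁))`. [folklore] -/
theorem fsRatio_coshift (Δ tpd tpp c a ε : ℝ) :
    fsRatio Δ tpd (tpp + a) (c + a) ε =
      -(fsN tpd tpp c ε + a * fsN1 tpd tpp c ε) /
        ((fsD Δ tpd c ε - a * fsD1 Δ ε) + 2 * (fsN tpd tpp c ε + a * fsN1 tpd tpp c ε)) := by
  unfold fsRatio
  rw [fsN_coshift, fsD_coshift]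

/-- MORE AXIAL ADMIXTURE ⇒ MORE CUPRATE-LIKE FERMI SURFACE: for `0 ≤ a₁ ≤ a₂` with `n₁ ≥ 0`, `d₁ ≥ 0`,
`fsN > 0` and `fsD − a₂d₁ > 0` (the co-shifted model still in the charge-transfer regime), the ratio is
antitone: `t′/t(a₂) ≤ t′/t(a₁)`. [cite: PavariniEtAl2001, Fig. 3 (t′/t grows with the range parameter)] -/
theorem fsRatio_coshift_anti {Δ tpd tpp c ε a₁ a₂ : ℝ} (ha₁ : 0 ≤ a₁) (h12 : a₁ ≤ a₂)
    (hn₀ : 0 < fsN tpd tpp c ε) (hn₁ : 0 ≤ fsN1 tpd tpp c ε) (hd₁ : 0 ≤ fsD1 Δ ε)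
    (hd₂ : 0 < fsD Δ tpd c ε - a₂ * fsD1 Δ ε) :
    fsRatio Δ tpd (tpp + a₂) (c + a₂) ε ≤ fsRatio Δ tpd (tpp + a₁) (c + a₁) ε := by
  rw [fsRatio_coshift, fsRatio_coshift]
  set n₀ := fsN tpd tpp c ε
  set n₁ := fsN1 tpd tpp c ε
  set d₀ := fsD Δ tpd c ε
  set d₁ := fsD1 Δ ε
  have hnA : 0 < n₀ + a₁ * n₁ := by nlinarith
  have hnB : n₀ + a₁ * n₁ ≤ n₀ + a₂ * n₁ := by nlinarith
  have hdA : d₀ - a₂ * d₁ ≤ d₀ - a₁ * d₁ := by nlinarith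
  calc -(n₀ + a₂ * n₁) / (d₀ - a₂ * d₁ + 2 * (n₀ + a₂ * n₁))
      ≤ -(n₀ + a₁ * n₁) / (d₀ - a₂ * d₁ + 2 * (n₀ + a₁ * n₁)) := neg_div_add_anti_n hd₂ hnA hnB
    _ ≤ -(n₀ + a₁ * n₁) / (d₀ - a₁ * d₁ + 2 * (n₀ + a₁ * n₁)) := neg_div_add_mono_d hd₂ hdA hnA

/-- The axial admixture reproducing a prescribed Fermi-surface ratio `R`:
`a* = −(R(d₀ + 2n₀) + n₀)/(R(2n₁ − d₁) + n₁)`. [folklore] -/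
def axialAdmixture (R n₀ n₁ d₀ d₁ : ℝ) : ℝ := -(R * (d₀ + 2 * n₀) + n₀) / (R * (2 * n₁ - d₁) + n₁)

/-- INVERSE MAP (closed form): if `R(2n₁ − d₁) + n₁ ≠ 0` and the co-shifted contour is non-degenerate
(`fsD − a*d₁ + 2(fsN + a*n₁) ≠ 0`), then at `a* = axialAdmixture R fsN n₁ fsD d₁` the full model's
Fermi-surface ratio EQUALS `R`: the axial admixture needed to carry a material's σ Fermi surface onto its
direct one-band (object-E) Fermi surface, with no bisection. [folklore] -/
theorem fsRatio_at_axialAdmixture {Δ tpd tpp c ε R : ℝ}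
    (hden : R * (2 * fsN1 tpd tpp c ε - fsD1 Δ ε) + fsN1 tpd tpp c ε ≠ 0)
    (hT : fsD Δ tpd c ε - axialAdmixture R (fsN tpd tpp c ε) (fsN1 tpd tpp c ε) (fsD Δ tpd c ε) (fsD1 Δ ε)
        * fsD1 Δ ε + 2 * (fsN tpd tpp c ε + axialAdmixture R (fsN tpd tpp c ε) (fsN1 tpd tpp c ε)
        (fsD Δ tpd c ε) (fsD1 Δ ε) * fsN1 tpd tpp c ε) ≠ 0) :
    fsRatio Δ tpd (tpp + axialAdmixture R (fsN tpd tpp c ε) (fsN1 tpd tpp c ε) (fsD Δ tpd c ε) (fsD1 Δ ε))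
        (c + axialAdmixture R (fsN tpd tpp c ε) (fsN1 tpd tpp c ε) (fsD Δ tpd c ε) (fsD1 Δ ε)) ε = R := by
  rw [fsRatio_coshift, div_eq_iff hT]
  unfold axialAdmixture at *
  set n₀ := fsN tpd tpp c ε
  set n₁ := fsN1 tpd tpp c ε
  set d₀ := fsD Δ tpd c ε
  set d₁ := fsD1 Δ ε
  field_simp
  ring

/-- Pavarini's parametrisation of the admixture: `a = t_sp²/(ε_s − ε)` is solved for the axial level by
`ε_s = ε + t_sp²/a` (`a ≠ 0`, `ε_s ≠ ε`). [cite: PavariniEtAl2001, text after Eq. (2)] -/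
theorem axialLevel_of_admixture {tsp εs ε a : ℝ} (ha : a ≠ 0) (hε : εs - ε ≠ 0)
    (h : a = tsp ^ 2 / (εs - ε)) : εs = ε + tsp ^ 2 / a := by
  have h2 : a * (εs - ε) = tsp ^ 2 := by
    rw [h]; field_simp
  field_simp
  linarith

end Summit.Ventures.CertifiedManyBodySolver.Downfold.Emery
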